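import Summits.CriticalPhenomena.PercolationContinuityZ3.Theorems.PercNearOneGluingNoHeavyPcintNawMemZ6M10Defs1
import Summits.CriticalPhenomena.PercolationContinuityZ3.Theorems.PercNearOneGluingNoHeavyPcintNawMemZ6M10Defs2
import Summits.CriticalPhenomena.PercolationContinuityZ3.Theorems.PercNearOneGluingNoHeavyPcintNawRandMemKernelSymTab
import HarnessLib

/-!
# PCINT lane, kernel reduced-state B2r certificate `Z6M10` (d = 6, memory τ = 10, 798 state classes): table root, symmetry table, parameters

Cell `prim-pcint`, seat `prim-pcint-1` (gen 5); memo `run/shared/lean/prim/pcint/INTERVAL-PLAN.md` §16 ("checker for the reduced-state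
automata").  Does NOT build on p205010.  Data for `NawK.le_siteCriticalProb_of_checkRows` (`…PcintNawRandMemKernelCert`): `p = 10060/100000`,
`q̄ = 99041/100000` (`q̄^11·100000^11 ≥ (100000-10060)·100000^10`), `κ̄ = (100000+99041)/(2·100000)`, `λ = 99999/100000`; Collatz–Wielandt weights (scale 10⁹) from a
power iteration, exact off-line max row ratio 0.9996917089 < λ.  Generated by gen5/gen_lean.py (pcint-1 folder); the kernel re-checks every row.
-/

noncomputable section

namespace Summit.CriticalPhenomena.PercolationContinuityZ3.Theorems.Pcint

namespace NawMemZ6M10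

set_option maxRecDepth 8000 in
/-- The certificate table (search tree keyed by row index). [folklore] -/
def tree : NawK.NT := (NawK.NT.node t_0_399 399 (713422940, [([-1,-1,-2,-1,0,0], 5), ([-1,-1,-2,0,0,0], 4), ([-1,-1,-1,0,0,0], 3), ([-1,-1,0,0,0,0], 2), ([-1,0,-2,-1,0,0], 6), ([-1,0,-1,-1,0,0], 7), ([-1,0,0,0,0,0], 1)], [some (38, 0), none, some (39, 2), none, some (40, 4), some (662, 5), some (42, 6), some (663, 7), some (42, 8), some (42, 9), some (42, 10), some (42, 11)]) t_400_798)

/-- The 12 signed permutations of `ℤ^6` used by the certificate, as tables. [folklore] -/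
def syms : List (List (ℕ × Bool)) := [[(0, true), (1, true), (2, true), (3, true), (4, true), (5, true)], [(0, false), (1, true), (2, true), (3, true), (4, true), (5, true)], [(1, true), (0, true), (2, true), (3, true), (4, true), (5, true)], [(1, true), (0, false), (2, true), (3, true), (4, true), (5, true)], [(1, true), (2, true), (0, true), (3, true), (4, true), (5, true)], [(1, true), (2, true), (0, false), (3, true), (4, true), (5, true)], [(1, true), (2, true), (3, true), (0, true), (4, true), (5, true)], [(1, true), (2, true), (3, true), (0, false), (4, true), (5, true)], [(1, true), (2, true), (3, true), (4, true), (0, true), (5, true)], [(1, true), (2, true), (3, true), (4, true), (0, false), (5, true)], [(1, true), (2, true), (3, true), (4, true), (5, true), (0, true)], [(1, true), (2, true), (3, true), (4, true), (5, true), (0, false)]]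

/-- Every table is a valid signed permutation table. [folklore] -/
theorem syms_valid : syms.all (NawK.validTab 6) = true := by decide +kernel

/-- The row check of this certificate. [folklore] -/
def chk (i : ℕ) : Bool := NawK.checkRow 10 6 798 10060 99041 100000 99999 100000 syms tree i

end NawMemZ6M10

end Summit.CriticalPhenomena.PercolationContinuityZ3.Theorems.Pcint
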